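import Summits.ValiantsHypothesis.ValiantsHypothesis.Theorems.DepthWindowNodeBias
import HarnessLib.Audit.Tags

/-!
# Route `DepthWindow` — imbalance laws force a HIGH-BIAS NODE in every tree (the descent lemma)

Cone-free helper (decomp-valiant workshop, lens 4 «depth-reduction / chasm axis», generation 14) supporting the
crux item `HomImmHardTwoOne` (stmt-ValiantsHypothesis-30635) of `Theses/DepthWindow.lean`.  Generation 13 typed
the BUILDER's side of the tree-bias door (`nodeBias`, `LowBiasTree`, the conjecture family `UniversalLowBiasAt C`,
and the top rung `ULB_∞`: `DepthWindowNodeBias*.lean`); the critic (bus 648, NEXT (b)) asked for the one missing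
kernel piece on the ADVERSARY's side: a LOWER bound on node bias at an intermediate depth, making «`ULB_1` is
false» a kernel fact.  This file is the combinatorial core of that lower bound, stated over the SAME threshold-law
interface `(θ, κ)` that drives the flat relative-rank induction `Law.relRank_eval_le_law`
(`DepthWindowGenFlatRank.lean`, = [LimayeSrinivasanTavenas2025] Claim 16 / [BhargavDuttaSaxena2024] Lemma 4.3):

* `card_mul_le_nodeBias` : if every child `c` of a node `v` obeys `|c|·κ ≤ |Sum(c)|` then `|v|·κ ≤ nodeBias(v)`
  (the children of `v` partition `v`);
* `exists_nodeBias_ge_of_law` (**descent lemma**) : if the integer word `w` on `d` letters satisfies the laws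
  «`|W| < θ_p ⇒ |W|·κ_p ≤ |Sum(W)|`» for `p < Δ`, with `1 < θ_p`, `0 ≤ κ_p`, steps `E ≤ κ_p·θ_{p+1}` and fit
  `θ_Δ ≤ d`, then EVERY levelled tree whose level `Δ` is a single block has a node at some level `1 ≤ u ≤ Δ` of
  node bias `≥ E`.  Proof: take the LOWEST level `u ≥ 1` carrying a block of size `≥ θ_u` (the root qualifies by
  the fit); its children all have size `< θ_{u-1}` (at `u = 1` they are singletons and `1 < θ_0`), so the law at
  `u - 1` prices each child and `nodeBias ≥ κ_{u-1}·θ_u ≥ E`.  This is the node-bias reading of the depth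
  induction of LST/BDS (a product gate either has a large factor — descend — or its small factors carry the whole
  degree and their biases add up);
* `treeBiasGe_of_law`, `not_lowBiasTree_of_law` : the same in the currencies of g12/g13 (`TreeBiasGe`, Prop. 17
  direction `treeBiasGe_of_nodeBias`; `¬ LowBiasTree w Δ β` for every `β < E`).

The Bhargav–Dutta–Saxena two-letter word instantiates the interface with `E = qtλ/32` at every depth `Δ` with
`λ^{F_{Δ+2}} ≤ λ d` (`DepthWindowNodeBiasBDS.lean`), whence `TreeBiasGrowthAt 1` and `¬ UniversalLowBiasAt 1`
(`DepthWindowTreeBiasGrowthOne.lean`).  Unconditional, 0 sorry, definition-free; rung currency only — nothing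
here bears on `VP ≠ VNP` itself.

References: [LimayeSrinivasanTavenas2022] CCC 2022 (LIPIcs 234:32) Def. 2; full version ECCC TR22-090 Def. 15,
Prop. 17; [LimayeSrinivasanTavenas2025] J. ACM 72 (2025) Art. 26, Claim 16; [BhargavDuttaSaxena2024] ACM ToCT
16(4):23 (2024), Lemma 4.3.
-/

-- layout Summits/ValiantsHypothesis/ValiantsHypothesis forces the duplicated namespace component
set_option linter.dupNamespace false

namespace Summit.ValiantsHypothesis.ValiantsHypothesis.Theorems.DepthWindow.TreeBias

open Finset

variable {d : ℕ}

/-! ### The children of a node partition it -/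

/-- If every child `c` of the level-`u` node of leaf `i` (`u ≥ 1`; the children are the level-`(u-1)` blocks
inside it) satisfies `|c|·κ ≤ |Sum(c)|`, then `|node|·κ ≤ nodeBias(node)`: the children partition the node.
[cite: LimayeSrinivasanTavenas2022, Def. 15] -/
theorem card_mul_le_nodeBias (w : Fin d → ℤ) (T : LTree d) {u : ℕ} (hu : 1 ≤ u) (i : Fin d) {κ : ℝ}
    (h : ∀ j, T.lab u j = T.lab u i →
      (((univ.filter fun k => T.lab (u - 1) k = T.lab (u - 1) j).card : ℕ) : ℝ) * κ ≤
        |((blockSum w T (u - 1) (T.lab (u - 1) j) : ℤ) : ℝ)|) :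
    (((univ.filter fun j => T.lab u j = T.lab u i).card : ℕ) : ℝ) * κ ≤ ((nodeBias w T u i : ℤ) : ℝ) := by
  classical
  set s := univ.filter fun j => T.lab u j = T.lab u i with hs
  -- the fibres of `lab (u-1)` over `s` are whole level-`(u-1)` blocks
  have hfib : ∀ l ∈ s.image (T.lab (u - 1)),
      s.filter (fun k => T.lab (u - 1) k = l) = univ.filter fun k => T.lab (u - 1) k = l := by
    intro l hl
    obtain ⟨j, hj, rfl⟩ := mem_image.1 hl
    have hj' : T.lab u j = T.lab u i := (mem_filter.1 hj).2
    ext k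
    simp only [hs, mem_filter, mem_univ, true_and]
    constructor
    · exact fun hk => hk.2
    · intro hk
      refine ⟨?_, hk⟩
      have hr := T.refine (u - 1) k j hk
      rw [Nat.sub_add_cancel hu] at hr
      exact hr.trans hj'
  have hcard : s.card = ∑ l ∈ s.image (T.lab (u - 1)), (univ.filter fun k => T.lab (u - 1) k = l).card := by
    rw [card_eq_sum_card_fiberwise (fun j hj => mem_image_of_mem (T.lab (u - 1)) hj)]
    exact sum_congr rfl fun l hl => by rw [hfib l hl]
  unfold nodeBias
  rw [← hs, hcard]
  push_cast
  rw [sum_mul]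
  refine sum_le_sum fun l hl => ?_
  obtain ⟨j, hj, rfl⟩ := mem_image.1 hl
  exact h j (mem_filter.1 hj).2

/-! ### The descent lemma -/

/-- **Descent lemma.**  Let the integer word `w` on `d` letters satisfy, for every level `p < Δ`, the imbalance
law «every letter set `W` with `|W| < θ_p` has `|W|·κ_p ≤ |Sum(W)|`», with `1 < θ_p`, `0 ≤ κ_p`, the step
inequalities `E ≤ κ_p · θ_{p+1}` and the fit `θ_Δ ≤ d`.  Then every levelled tree on the `d` letters whose level
`Δ` is a single block has, at some level `1 ≤ u ≤ Δ`, a node of node bias at least `E`.  (The node-bias form of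
the depth induction of [LimayeSrinivasanTavenas2025] Claim 16 / [BhargavDuttaSaxena2024] Lemma 4.3: the lowest
level `u ≥ 1` with a block of size `≥ θ_u` has all its children of size `< θ_{u-1}`, and the law prices them.)
[cite: BhargavDuttaSaxena2024, Lemma 4.3] [cite: LimayeSrinivasanTavenas2022, Def. 15] -/
theorem exists_nodeBias_ge_of_law (w : Fin d → ℤ) {Δ : ℕ} (hΔ : 1 ≤ Δ) {θ κ : ℕ → ℝ} {E : ℝ}
    (hθ1 : ∀ p, 1 < θ p)
    (hlaw : ∀ p, p < Δ → ∀ W : Finset (Fin d), (W.card : ℝ) < θ p →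
      (W.card : ℝ) * κ p ≤ |((∑ j ∈ W, w j : ℤ) : ℝ)|)
    (hκ : ∀ p, p < Δ → 0 ≤ κ p)
    (hstep : ∀ p, p < Δ → E ≤ κ p * θ (p + 1))
    (hfit : θ Δ ≤ d)
    (T : LTree d) (hroot : ∀ i j, T.lab Δ i = T.lab Δ j) :
    ∃ u : ℕ, ∃ i : Fin d, 1 ≤ u ∧ u ≤ Δ ∧ E ≤ ((nodeBias w T u i : ℤ) : ℝ) := by
  classical
  -- descending induction on the level carrying a big block
  have key : ∀ u, u ≤ Δ →
      (∃ i, θ u ≤ (((univ.filter fun j => T.lab u j = T.lab u i).card : ℕ) : ℝ)) → 1 ≤ u →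
      ∃ u' : ℕ, ∃ i' : Fin d, 1 ≤ u' ∧ u' ≤ Δ ∧ E ≤ ((nodeBias w T u' i' : ℤ) : ℝ) := by
    intro u
    induction u with
    | zero => intro _ _ h; exact absurd h (by omega)
    | succ u ih =>
      intro huΔ hbig _
      by_cases hdown : 1 ≤ u ∧ ∃ i, θ u ≤ (((univ.filter fun j => T.lab u j = T.lab u i).card : ℕ) : ℝ)
      · exact ih (by omega) hdown.2 hdown.1
      · -- every level-`u` block is small
        have hsmall : ∀ j, (((univ.filter fun k => T.lab u k = T.lab u j).card : ℕ) : ℝ) < θ u := by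
          intro j
          rcases Nat.eq_zero_or_pos u with hu0 | hu0
          · subst hu0
            have hsing : (univ.filter fun k => T.lab 0 k = T.lab 0 j) = {j} := by
              ext k
              simp [T.leaf]
            rw [hsing, card_singleton, Nat.cast_one]
            exact hθ1 0
          · by_contra hge
            exact hdown ⟨hu0, j, not_lt.1 hge⟩
        obtain ⟨i, hi⟩ := hbig
        have hlt : u < Δ := by omega
        refine ⟨u + 1, i, by omega, huΔ, ?_⟩
        have hnb := card_mul_le_nodeBias w T (by omega : 1 ≤ u + 1) i (κ := κ u) (fun j _ => by
          simp only [Nat.add_sub_cancel]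
          have hl := hlaw u hlt (univ.filter fun k => T.lab u k = T.lab u j) (hsmall j)
          unfold blockSum
          exact hl)
        calc E ≤ κ u * θ (u + 1) := hstep u hlt
          _ ≤ κ u * (((univ.filter fun j => T.lab (u + 1) j = T.lab (u + 1) i).card : ℕ) : ℝ) :=
              mul_le_mul_of_nonneg_left hi (hκ u hlt)
          _ = (((univ.filter fun j => T.lab (u + 1) j = T.lab (u + 1) i).card : ℕ) : ℝ) * κ u := mul_comm _ _
          _ ≤ ((nodeBias w T (u + 1) i : ℤ) : ℝ) := hnb
  -- the root is a block of size `d ≥ θ_Δ`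
  have hd : 0 < d := by
    have h1 : (1 : ℝ) < d := lt_of_lt_of_le (hθ1 Δ) hfit
    exact_mod_cast (zero_lt_one.trans h1)
  refine key Δ le_rfl ⟨⟨0, hd⟩, ?_⟩ hΔ
  rw [filter_true_of_mem (fun j _ => hroot j ⟨0, hd⟩), card_univ, Fintype.card_fin]
  exact hfit

/-! ### The same in tree-bias and low-bias-tree currency -/

/-- Laws ⇒ **tree bias** (Prop. 17 direction `treeBiasGe_of_nodeBias`): under the hypotheses of the descent
lemma, `Treebias_Δ(w) ≥ τ` for every `τ` with `τ + |Sum(w)| ≤ E`.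
[cite: LimayeSrinivasanTavenas2022, Prop. 17] [cite: BhargavDuttaSaxena2024, Lemma 4.3] -/
theorem treeBiasGe_of_law (w : Fin d → ℤ) {Δ : ℕ} (hΔ : 1 ≤ Δ) {θ κ : ℕ → ℝ} {E : ℝ}
    (hθ1 : ∀ p, 1 < θ p)
    (hlaw : ∀ p, p < Δ → ∀ W : Finset (Fin d), (W.card : ℝ) < θ p →
      (W.card : ℝ) * κ p ≤ |((∑ j ∈ W, w j : ℤ) : ℝ)|)
    (hκ : ∀ p, p < Δ → 0 ≤ κ p)
    (hstep : ∀ p, p < Δ → E ≤ κ p * θ (p + 1))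
    (hfit : θ Δ ≤ d) {τ : ℕ} (hτ : (τ : ℝ) + |((∑ j, w j : ℤ) : ℝ)| ≤ E) :
    TreeBiasGe w Δ τ :=
  treeBiasGe_of_nodeBias fun T hroot => by
    obtain ⟨u, i, hu1, huΔ, hE⟩ := exists_nodeBias_ge_of_law w hΔ hθ1 hlaw hκ hstep hfit T hroot
    refine ⟨u, i, hu1, huΔ, ?_⟩
    have h : ((τ : ℕ) : ℝ) + |((∑ j, w j : ℤ) : ℝ)| ≤ ((nodeBias w T u i : ℤ) : ℝ) := hτ.trans hE
    exact_mod_cast h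

/-- Laws ⇒ **no low-bias tree**: under the hypotheses of the descent lemma there is no depth-`Δ` tree of node bias
`≤ β` when `β < E` — the form in which the conjectures `UniversalLowBiasAt C` are refuted.
[cite: LimayeSrinivasanTavenas2022, Prop. 17] [cite: BhargavDuttaSaxena2024, Lemma 4.3] -/
theorem not_lowBiasTree_of_law (w : Fin d → ℤ) {Δ : ℕ} (hΔ : 1 ≤ Δ) {θ κ : ℕ → ℝ} {E : ℝ}
    (hθ1 : ∀ p, 1 < θ p)
    (hlaw : ∀ p, p < Δ → ∀ W : Finset (Fin d), (W.card : ℝ) < θ p →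
      (W.card : ℝ) * κ p ≤ |((∑ j ∈ W, w j : ℤ) : ℝ)|)
    (hκ : ∀ p, p < Δ → 0 ≤ κ p)
    (hstep : ∀ p, p < Δ → E ≤ κ p * θ (p + 1))
    (hfit : θ Δ ≤ d) {β : ℤ} (hβ : (β : ℝ) < E) :
    ¬ LowBiasTree w Δ β := by
  rintro ⟨T, hroot, hle⟩
  obtain ⟨u, i, hu1, huΔ, hE⟩ := exists_nodeBias_ge_of_law w hΔ hθ1 hlaw hκ hstep hfit T hroot
  have h1 : ((nodeBias w T u i : ℤ) : ℝ) ≤ β := by exact_mod_cast hle u hu1 huΔ i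
  linarith

end Summit.ValiantsHypothesis.ValiantsHypothesis.Theorems.DepthWindow.TreeBias
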